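import Summits.RiemannHypothesis.RiemannHypothesis.Theses.GapsEvoDoors
import Literature.NumberTheory.LFunctions.ZetaSpacingDensityRHProofs

/-!
# GapsEvoDoors — Montgomery's theorem against a SIGNED test function on `[−1, 1]` (two-sided Goldston–Montgomery form)

Route `GapsEvoDoors`, analytic support for the door-(a″) multiplicity criterion
`FFMultiplicityCriterionAll` (item stmt-RiemannHypothesis-23129; also usable for the two-sided
fragment criterion 22422). In Bui–Goldston–Milinovich–Montgomery 2023, Proposition 1 (tree
`BGMM2023.pairCount_ge_of_RH`, `ZetaSpacingDensityRHProofs.lean`) the test function `r̂` is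
non-negative, so Montgomery's theorem on `[−1, 1]` is only needed as a LOWER bound against a
non-negative weight. For an UPPER bound (the `N*` direction, Montgomery 1973 §3) or a signed
weight one needs the two-sided statement, proved here from the tree's Montgomery theorem with the
Goldston–Montgomery error (`Montgomery.montgomery_pair_correlation_sqrtLog`:
`|F − (T^{−2|α|} log T + |α|)| ≤ C (T^{−2|α|} log T + 1)/√log T` on `|α| ≤ 1`) and the kernel
masses `∫_{−w}^{w} T^{−2|α|} log T dα → 1` (`Montgomery.tendsto_integral_rpow_abs_mul_log_mul`):

* `kernel_integral_ge` — the mass of a kernel `K ≥ 0` at `0` against a signed continuous bounded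
  `g`, using only CONTINUITY of `g` at `0`: if `∫_{−1}^{1} K` and `∫_{−δ₁}^{δ₁} K` are within `η₁`
  of `1`, `|g| ≤ B` and `g ≥ g(0) − η₁` on `[−δ₁, δ₁]`, then `∫_{−1}^{1} K g ≥ g(0) − η₁(2 + 3B)`;
* `window_integral_ge` — on RH, for `g` continuous with `|g| ≤ B` and `0 < η₁ ≤ ½`, for all
  large `T`: `∫_{−1}^{1} F(α,T) g(α) dα ≥ g(0) + ∫_{−1}^{1} |α| g(α) dα − η₁(2 + 7B)`.
  Applied to `−g` it is the matching UPPER bound, so `∫_{−1}^{1} F g → g(0) + ∫_{−1}^{1}|α| g`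
  for every continuous bounded `g` (no sign, no Lipschitz condition at `0`; compare the tree's
  `Montgomery.tendsto_integral_formFactor_mul_of_subset_Icc`, which asks `g` Lipschitz at `0`).

RH is the antecedent. RH-sentence (c): a record INSIDE route GapsEvoDoors (door (a″)/(a)
bookkeeping) — toward RiemannHypothesis: 0. Nothing here bears on the truth of RH.
-/


noncomputable section

open Filter Set MeasureTheory Real Finset Literature.NumberTheory.LFunctions
open Literature.NumberTheory.LFunctions.BGMM2023
open scoped Topology FourierTransform

set_option linter.dupNamespace false  -- the mandated namespace repeats `RiemannHypothesis`

namespace Summit.RiemannHypothesis.RiemannHypothesis.Theorems.GapsEvoDoorsFF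

/-- **The kernel mass at `0` against a SIGNED continuous test function.** If `K ≥ 0` is
continuous with `|∫_{−1}^{1} K − 1| < η₁` and `|∫_{−δ₁}^{δ₁} K − 1| < η₁` (`η₁ ≤ ½`, `δ₁ ≤ 1`), and
`g` is continuous with `|g| ≤ B` and `g ≥ g(0) − η₁` on `[−δ₁, δ₁]`, then
`∫_{−1}^{1} K g ≥ g(0) − η₁(2 + 3B)` (split `[−1,1]` at `±δ₁`; the annulus has `K`-mass `< 2η₁`). -/
theorem kernel_integral_ge {K g : ℝ → ℝ} (hKc : Continuous K) (hK0 : ∀ a, 0 ≤ K a)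
    (hgc : Continuous g) {B : ℝ} (hgB : ∀ a, |g a| ≤ B) {η₁ δ₁ : ℝ} (hη₁0 : 0 < η₁)
    (hη₁1 : η₁ ≤ 1 / 2) (hδ₁0 : 0 < δ₁) (hδ₁1 : δ₁ ≤ 1)
    (hgδ : ∀ a ∈ Set.Icc (-δ₁) δ₁, g 0 - η₁ ≤ g a)
    (hm₁ : |(∫ a in (-1 : ℝ)..1, K a) - 1| < η₁) (hmδ : |(∫ a in (-δ₁)..δ₁, K a) - 1| < η₁) :
    g 0 - η₁ * (2 + 3 * B) ≤ ∫ a in (-1 : ℝ)..1, K a * g a := by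
  have hB0 : 0 ≤ B := (abs_nonneg _).trans (hgB 0)
  have hgB' : ∀ a, g a ≤ B := fun a ↦ (le_abs_self _).trans (hgB a)
  have hgB'' : ∀ a, -B ≤ g a := fun a ↦ (abs_le.1 (hgB a)).1
  have hKgc : Continuous fun a ↦ K a * g a := hKc.mul hgc
  have hKi : ∀ a b : ℝ, IntervalIntegrable K volume a b := fun a b ↦ hKc.intervalIntegrable _ _
  have hKgi : ∀ a b : ℝ, IntervalIntegrable (fun a ↦ K a * g a) volume a b :=
    fun a b ↦ hKgc.intervalIntegrable _ _
  -- split `[−1, 1]` at `±δ₁`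
  have hXsplit : (∫ a in (-1 : ℝ)..(-δ₁), K a * g a) + (∫ a in (-δ₁)..δ₁, K a * g a) +
      (∫ a in δ₁..1, K a * g a) = ∫ a in (-1 : ℝ)..1, K a * g a := by
    rw [intervalIntegral.integral_add_adjacent_intervals (hKgi _ _) (hKgi _ _),
      intervalIntegral.integral_add_adjacent_intervals (hKgi _ _) (hKgi _ _)]
  have hann : (∫ a in (-1 : ℝ)..(-δ₁), K a) + (∫ a in δ₁..1, K a) =
      (∫ a in (-1 : ℝ)..1, K a) - (∫ a in (-δ₁)..δ₁, K a) := by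
    have e1 := intervalIntegral.integral_add_adjacent_intervals (hKi (-1) (-δ₁)) (hKi (-δ₁) δ₁)
    have e2 := intervalIntegral.integral_add_adjacent_intervals (hKi (-1) δ₁) (hKi δ₁ 1)
    linarith
  -- the three pieces
  have hmid : (g 0 - η₁) * (∫ a in (-δ₁)..δ₁, K a) ≤ ∫ a in (-δ₁)..δ₁, K a * g a := by
    rw [← intervalIntegral.integral_const_mul]
    refine intervalIntegral.integral_mono_on (by linarith) ((hKi _ _).const_mul _)
      (hKgi _ _) fun a ha ↦ ?_
    rw [mul_comm]
    exact mul_le_mul_of_nonneg_left (hgδ a ha) (hK0 a)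
  have hleft : -B * (∫ a in (-1 : ℝ)..(-δ₁), K a) ≤ ∫ a in (-1 : ℝ)..(-δ₁), K a * g a := by
    rw [← intervalIntegral.integral_const_mul]
    refine intervalIntegral.integral_mono_on (by linarith) ((hKi _ _).const_mul _)
      (hKgi _ _) fun a _ ↦ ?_
    have := mul_le_mul_of_nonneg_left (hgB'' a) (hK0 a)
    linarith
  have hright : -B * (∫ a in δ₁..1, K a) ≤ ∫ a in δ₁..1, K a * g a := by
    rw [← intervalIntegral.integral_const_mul]
    refine intervalIntegral.integral_mono_on hδ₁1 ((hKi _ _).const_mul _)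
      (hKgi _ _) fun a _ ↦ ?_
    have := mul_le_mul_of_nonneg_left (hgB'' a) (hK0 a)
    linarith
  -- `(g 0 − η₁)·mδ ≥ g 0 − 2η₁ − η₁ B`
  have hmid' : g 0 - 2 * η₁ - η₁ * B ≤ (g 0 - η₁) * (∫ a in (-δ₁)..δ₁, K a) := by
    have hmδ1 := (abs_lt.1 hmδ).1
    have hmδ2 := (abs_lt.1 hmδ).2
    have hg0B : g 0 ≤ B := hgB' 0
    have hg0B' : -B ≤ g 0 := hgB'' 0
    have hsq : η₁ ^ 2 ≤ η₁ := by nlinarith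
    rcases le_or_gt 0 (g 0 - η₁) with h0 | h0
    · have hle : 1 - η₁ ≤ ∫ a in (-δ₁)..δ₁, K a := by linarith
      have h5 := mul_le_mul_of_nonneg_left hle h0
      have h6 : η₁ * g 0 ≤ η₁ * B := mul_le_mul_of_nonneg_left hg0B hη₁0.le
      have e : (g 0 - η₁) * (1 - η₁) = g 0 - η₁ - η₁ * g 0 + η₁ ^ 2 := by ring
      linarith [sq_nonneg η₁]
    · have hle : (∫ a in (-δ₁)..δ₁, K a) ≤ 1 + η₁ := by linarith
      have h5 := mul_le_mul_of_nonpos_left hle h0.le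
      have h6 : η₁ * (-B) ≤ η₁ * g 0 := mul_le_mul_of_nonneg_left hg0B' hη₁0.le
      have e : (g 0 - η₁) * (1 + η₁) = g 0 - η₁ + η₁ * g 0 - η₁ ^ 2 := by ring
      linarith
  -- the annulus
  have hm := (abs_lt.1 hm₁).2
  have hm' := (abs_lt.1 hmδ).1
  have e1 : -B * (∫ a in (-1 : ℝ)..(-δ₁), K a) + -B * (∫ a in δ₁..1, K a) =
      -B * ((∫ a in (-1 : ℝ)..1, K a) - (∫ a in (-δ₁)..δ₁, K a)) := by
    rw [← mul_add, hann]
  have e2 : -B * (2 * η₁) ≤ -B * ((∫ a in (-1 : ℝ)..1, K a) - (∫ a in (-δ₁)..δ₁, K a)) :=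
    mul_le_mul_of_nonpos_left (by linarith) (by linarith)
  linarith only [hXsplit, hmid, hleft, hright, hmid', e1, e2]

/-- **Montgomery's theorem against a SIGNED continuous bounded test function on `[−1, 1]`, lower
bound.** On RH, for `g` continuous with `|g| ≤ B` and `0 < η₁ ≤ ½`: for all large `T`,
`∫_{−1}^{1} F(α,T) g(α) dα ≥ g(0) + ∫_{−1}^{1} |α| g(α) dα − η₁(2 + 7B)`. Pointwise
`|F − (K + |α|)| ≤ η₁(K + 1)` with `K = T^{−2|α|} log T` (Goldston–Montgomery error, `T` large), so
`F g ≥ K g + |α| g − η₁ B (K + 1)`; then `kernel_integral_ge` and `∫_{−1}^{1} K → 1`. -/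
theorem window_integral_ge (hRH : _root_.RiemannHypothesis) {g : ℝ → ℝ} (hgc : Continuous g)
    {B : ℝ} (hgB : ∀ a, |g a| ≤ B) {η₁ : ℝ} (hη₁0 : 0 < η₁) (hη₁1 : η₁ ≤ 1 / 2) :
    ∀ᶠ T : ℝ in atTop, g 0 + (∫ a in (-1 : ℝ)..1, |a| * g a) - η₁ * (2 + 7 * B) ≤
      ∫ a in (-1 : ℝ)..1, montgomeryFormFactor a T * g a := by
  have hB0 : 0 ≤ B := (abs_nonneg _).trans (hgB 0)
  -- continuity of `g` at `0`
  obtain ⟨δ₀, hδ₀, hδ⟩ : ∃ δ₀ > 0, ∀ a : ℝ, |a| < δ₀ → |g a - g 0| < η₁ := by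
    obtain ⟨δ₀, hδ₀, h⟩ := Metric.continuous_iff.1 hgc 0 η₁ hη₁0
    refine ⟨δ₀, hδ₀, fun a ha ↦ ?_⟩
    have := h a (by rwa [Real.dist_eq, sub_zero])
    rwa [Real.dist_eq] at this
  set δ₁ : ℝ := min (δ₀ / 2) 1 with hδ₁def
  have hδ₁0 : 0 < δ₁ := lt_min (half_pos hδ₀) one_pos
  have hδ₁1 : δ₁ ≤ 1 := min_le_right _ _
  have hgδ : ∀ a ∈ Set.Icc (-δ₁) δ₁, g 0 - η₁ ≤ g a := by
    intro a ha
    have h1 : |a| < δ₀ := by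
      rw [abs_lt]; constructor <;> linarith [ha.1, ha.2, min_le_left (δ₀ / 2) 1]
    have h2 := hδ a h1
    rw [abs_lt] at h2; linarith [h2.1]
  -- Montgomery's theorem and the kernel masses
  obtain ⟨C, hC⟩ := Montgomery.montgomery_pair_correlation_sqrtLog hRH
  have hK : ∀ {w : ℝ}, 0 < w →
      Tendsto (fun T : ℝ ↦ ∫ a in (-w)..w, T ^ (-2 * |a|) * Real.log T) atTop (𝓝 1) := by
    intro w hw
    have h := Montgomery.tendsto_integral_rpow_abs_mul_log_mul hw (h := fun _ ↦ (1 : ℝ))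
      intervalIntegrable_const (B := 1) (fun a _ ↦ by simp) (Cg := 0) (δ := 1) one_pos
      (fun a _ ↦ by simp)
    simpa using h
  filter_upwards [hC, eventually_gt_atTop (1 : ℝ), eventually_ge_atTop (Real.exp ((|C| / η₁) ^ 2)),
    (hK hδ₁0).eventually (Metric.ball_mem_nhds (1 : ℝ) hη₁0),
    (hK one_pos).eventually (Metric.ball_mem_nhds (1 : ℝ) hη₁0)] with T hCT hT1 hTexp hKδ hK1
  rw [Real.dist_eq] at hKδ hK1
  have hT0 : 0 < T := by linarith
  set L : ℝ := Real.log T with hLdef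
  have hL : 0 < L := Real.log_pos hT1
  -- `|C|/√L ≤ η₁`
  have hCL : |C| / Real.sqrt L ≤ η₁ := by
    have h1 : (|C| / η₁) ^ 2 ≤ L := by
      have := Real.log_le_log (Real.exp_pos _) hTexp
      rwa [Real.log_exp] at this
    have h2 : |C| / η₁ ≤ Real.sqrt L := Real.le_sqrt_of_sq_le h1
    have h3 : 0 < Real.sqrt L := Real.sqrt_pos.2 hL
    rw [div_le_iff₀ h3]
    rw [div_le_iff₀ hη₁0] at h2
    linarith [mul_comm η₁ (Real.sqrt L)]
  -- the kernel `K(α) = T^{−2|α|} log T`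
  set K : ℝ → ℝ := fun a ↦ T ^ (-2 * |a|) * L with hKdef
  have hKc : Continuous K := by
    have e : K = fun a ↦ Real.exp (Real.log T * (-2 * |a|)) * L := by
      funext a; simp only [hKdef]; rw [Real.rpow_def_of_pos hT0]
    rw [e]; fun_prop
  have hK0 : ∀ a, 0 ≤ K a := fun a ↦ mul_nonneg (Real.rpow_nonneg hT0.le _) hL.le
  have hFc : Continuous fun a : ℝ ↦ montgomeryFormFactor a T := by
    unfold montgomeryFormFactor; fun_prop
  -- Montgomery, two-sided: `|F − (K + |α|)| ≤ η₁ (K + 1)` on `[−1, 1]`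
  have hMont : ∀ a ∈ Set.Icc (-1 : ℝ) 1,
      |montgomeryFormFactor a T - (K a + |a|)| ≤ η₁ * (K a + 1) := by
    intro a ha
    have ha' : |a| ≤ 1 := abs_le.2 ⟨ha.1, ha.2⟩
    have h1 := hCT a ha'
    have hKa' : T ^ (-2 * |a|) * Real.log T = K a := by simp only [hKdef, hLdef]
    rw [hKa'] at h1
    have hs : 0 < Real.sqrt L := Real.sqrt_pos.2 hL
    have hKa1 : 0 ≤ K a + 1 := by linarith [hK0 a]
    have h2 : C * (K a + 1) / Real.sqrt L ≤ η₁ * (K a + 1) :=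
      calc C * (K a + 1) / Real.sqrt L ≤ |C| * (K a + 1) / Real.sqrt L :=
            div_le_div_of_nonneg_right (mul_le_mul_of_nonneg_right (le_abs_self C) hKa1) hs.le
        _ = |C| / Real.sqrt L * (K a + 1) := by rw [mul_div_right_comm]
        _ ≤ η₁ * (K a + 1) := mul_le_mul_of_nonneg_right hCL hKa1
    exact h1.trans h2
  -- pointwise: `F g ≥ K g + |α| g − η₁ B (K + 1)`
  have hpt : ∀ a ∈ Set.Icc (-1 : ℝ) 1,
      K a * g a + |a| * g a - η₁ * B * (K a + 1) ≤ montgomeryFormFactor a T * g a := by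
    intro a ha
    have h1 := hMont a ha
    have hη₁K : 0 ≤ η₁ * (K a + 1) := mul_nonneg hη₁0.le (by linarith [hK0 a])
    have h2 : |(montgomeryFormFactor a T - (K a + |a|)) * g a| ≤ η₁ * (K a + 1) * B := by
      rw [abs_mul]; exact mul_le_mul h1 (hgB a) (abs_nonneg _) hη₁K
    have h3 := (abs_le.1 h2).1
    have e : (montgomeryFormFactor a T - (K a + |a|)) * g a =
        montgomeryFormFactor a T * g a - K a * g a - |a| * g a := by ring
    rw [e] at h3
    linarith
  -- integrate over `[−1, 1]`
  have hKgc : Continuous fun a ↦ K a * g a := hKc.mul hgc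
  have hag : Continuous fun a : ℝ ↦ |a| * g a := by fun_prop
  have hlow : (∫ a in (-1 : ℝ)..1, K a * g a) + (∫ a in (-1 : ℝ)..1, |a| * g a) -
      η₁ * B * ((∫ a in (-1 : ℝ)..1, K a) + 2) ≤
      ∫ a in (-1 : ℝ)..1, montgomeryFormFactor a T * g a := by
    have i12 : IntervalIntegrable (fun a ↦ K a * g a + |a| * g a) volume (-1) 1 :=
      (hKgc.add hag).intervalIntegrable _ _
    have i3 : IntervalIntegrable (fun a ↦ η₁ * B * (K a + 1)) volume (-1) 1 :=
      (continuous_const.mul (hKc.add continuous_const)).intervalIntegrable _ _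
    have e3 : ∫ a in (-1 : ℝ)..1, η₁ * B * (K a + 1) = η₁ * B * ((∫ a in (-1 : ℝ)..1, K a) + 2) := by
      rw [intervalIntegral.integral_const_mul, intervalIntegral.integral_add
        (hKc.intervalIntegrable _ _) intervalIntegrable_const, intervalIntegral.integral_const,
        smul_eq_mul]
      norm_num
    have h1 : ∫ a in (-1 : ℝ)..1, (K a * g a + |a| * g a - η₁ * B * (K a + 1)) =
        (∫ a in (-1 : ℝ)..1, K a * g a) + (∫ a in (-1 : ℝ)..1, |a| * g a) -
          η₁ * B * ((∫ a in (-1 : ℝ)..1, K a) + 2) := by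
      rw [intervalIntegral.integral_sub i12 i3, intervalIntegral.integral_add
        (hKgc.intervalIntegrable _ _) (hag.intervalIntegrable _ _), e3]
    rw [← h1]
    exact intervalIntegral.integral_mono_on (by norm_num)
      ((by fun_prop : Continuous fun a : ℝ ↦
        K a * g a + |a| * g a - η₁ * B * (K a + 1)).intervalIntegrable _ _)
      ((hFc.mul hgc).intervalIntegrable _ _) fun a ha ↦ hpt a ha
  have hX : g 0 - η₁ * (2 + 3 * B) ≤ ∫ a in (-1 : ℝ)..1, K a * g a :=
    kernel_integral_ge hKc hK0 hgc hgB hη₁0 hη₁1 hδ₁0 hδ₁1 hgδ hK1 hKδ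
  have hm₁' : (∫ a in (-1 : ℝ)..1, K a) + 2 ≤ 4 := by have := (abs_lt.1 hK1).2; linarith
  have e1 : η₁ * B * ((∫ a in (-1 : ℝ)..1, K a) + 2) ≤ η₁ * B * 4 :=
    mul_le_mul_of_nonneg_left hm₁' (mul_nonneg hη₁0.le hB0)
  linarith only [hlow, hX, e1]

end Summit.RiemannHypothesis.RiemannHypothesis.Theorems.GapsEvoDoorsFF

end
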